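import Summits.Langlands.Langlands.Theorems.PhantomRMYoshidaResiduallyYoshidaLiftingNonsplitCommutant
import HarnessLib

/-!
# Stable-plane saturation over `ℤ̄_p` (stub `stub_stablePlaneSaturation`) — line `sector-klingen-split`

Stub-worker file of lead prover-line-stmt-Langlands-13639-c4-0 (crux `ResiduallyYoshidaLifting`, stmt-Langlands-13639,
skeleton rev 7, sub-goal T4), namespace `…SectorKlingenSplit.Fibre`.

**Statement (`stub_stablePlaneSaturation`).**  Let `ℤ̄_p = Valued.integer (PadicAlgCl p)` be the (non-discrete,
non-Noetherian) valuation ring of `ℚ̄_p = PadicAlgCl p`, let `M₁ : ℚ̄_p⁴ˣ²` have injective `M₁ *ᵥ ·` (its two columns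
span a plane `W ⊆ ℚ̄_p⁴`), and suppose `W` is stable under a family of INTEGRAL matrices `rint g`
(`rint g * M₁ = M₁ * T₀(g)`).  Then there are an integral `N : ℤ̄_p⁴ˣ²`, an invertible `A : ℚ̄_p²ˣ²` with `N = M₁ A`
(so the columns of `N` are again a basis of `W`), two rows `i ≠ j` in which `N` is the identity `2 × 2` block, and
INTEGRAL `2 × 2` matrices `T g` with `rint g * N = N * T g`.

**Proof** (the lattice-free replacement of "saturated rank-`2` submodules of `ℤ̄_p⁴` are free direct summands"; two
pivot steps, no Bézout / lattice theory).  Write `m₁, m₂` for the columns of `M₁` (as `M₁ *ᵥ e₀`, `M₁ *ᵥ e₁`).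
1. `m₁ ≠ 0` by injectivity; let `i` maximise `‖m₁ i‖`, `q₁ = m₁ i ≠ 0`, `n₁ = q₁⁻¹ m₁`: integral (all norms `≤ 1`,
   `mem_integer_iff_norm_le_one`) with `n₁ i = 1` (`exists_maxEntry_smul_mem_integer`).
2. `m₂' = m₂ - (m₂ i) n₁` has `m₂' i = 0` and `m₂' ≠ 0` (injectivity: its coefficient vector has second entry `1`);
   let `j` maximise `‖m₂' j‖`; then `j ≠ i`, and `n₂ = (m₂' j)⁻¹ m₂'` is integral with `n₂ j = 1`, `n₂ i = 0`.
3. `n₁' = n₁ - (n₁ j) n₂` is integral (`ℤ̄_p` is a subring) with `n₁' i = 1`, `n₁' j = 0`.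
`N = (n₁' | n₂) = M₁ A` for the recorded coefficient matrix `A`; `A` is injective, hence invertible, because
`M₁ A = N` is injective (coordinates `i, j` of `N *ᵥ a` are `a 0, a 1`) (`isUnit_det_of_identityRows`).
Stability: `rint g * N = M₁ T₀ A = N (A⁻¹ T₀ A)`, and rows `i, j` of `N S` are the rows of `S`, so
`S = A⁻¹ T₀ A` is the `2 × 2` matrix of rows `i, j` of the INTEGRAL matrix `rint g * N` (`mul_eq_mul_of_identityRows`);
the identity over `ℤ̄_p` follows from injectivity of `ℤ̄_p → ℚ̄_p` on matrices.

Uses only Mathlib and `mem_integer_iff_norm_le_one` (…SplitFrame).  Consumed residually by orientation rigidity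
(`stub_residualPlaneOrientation`) and by the lead's irreducibility theorem for symplectic realisers.
-/

noncomputable section

open scoped MatrixGroups Matrix

-- `Summit.Langlands.Langlands.…` (summit = sub-problem name, D-0017 layout) trips `dupNamespace` on every decl.
set_option linter.dupNamespace false
set_option autoImplicit false

namespace Summit.Langlands.Langlands.Cruxes.ResiduallyYoshidaLifting.SectorKlingenSplit.Fibre

open Summit.Langlands.Langlands.Cruxes.ResiduallyYoshidaLifting.EndoscopicCrossingEuler

/-! ### Linear algebra of an identity `2 × 2` block (any field) -/

section IdentityRows

variable {F : Type*} [Field F]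

/-- If `M₁ * A` carries an identity `2 × 2` block in rows `i, j`, then the square matrix `A` is invertible:
`A a = 0 ⇒ (M₁ A) a = 0 ⇒ a 0 = a 1 = 0`, so `A *ᵥ ·` is injective. [folklore] -/
theorem isUnit_det_of_identityRows (M₁ : Matrix (Fin 4) (Fin 2) F) (A : Matrix (Fin 2) (Fin 2) F) (i j : Fin 4)
    (hi0 : (M₁ * A) i 0 = 1) (hi1 : (M₁ * A) i 1 = 0) (hj0 : (M₁ * A) j 0 = 0)
    (hj1 : (M₁ * A) j 1 = 1) : IsUnit A.det := by
  rw [← Matrix.isUnit_iff_isUnit_det, ← Matrix.mulVec_injective_iff_isUnit]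
  have hker : ∀ v : Fin 2 → F, A *ᵥ v = 0 → v = 0 := by
    intro v hv
    have hN : (M₁ * A) *ᵥ v = 0 := by
      rw [← Matrix.mulVec_mulVec, hv, Matrix.mulVec_zero]
    have h0 := congrFun hN i
    have h1 := congrFun hN j
    simp only [Matrix.mulVec, dotProduct, Fin.sum_univ_two, hi0, hi1, hj0, hj1, Pi.zero_apply, one_mul,
      zero_mul, add_zero, zero_add] at h0 h1
    funext r
    fin_cases r
    · exact h0
    · exact h1
  intro v w hvw
  rw [← sub_eq_zero]
  exact hker _ (by rw [Matrix.mulVec_sub, hvw, sub_self])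

/-- If `Nk = M₁ * A` with `A` invertible carries an identity block in rows `i, j` and the column span of `M₁` is
stable under `R` (`R * M₁ = M₁ * T₀`), then `R * Nk = Nk * S` where `S` is the `2 × 2` matrix of rows `i, j` of
`R * Nk`. [folklore] -/
theorem mul_eq_mul_of_identityRows (M₁ Nk : Matrix (Fin 4) (Fin 2) F) (A : Matrix (Fin 2) (Fin 2) F)
    (hA : IsUnit A.det) (hN : Nk = M₁ * A) (i j : Fin 4)
    (hi0 : Nk i 0 = 1) (hi1 : Nk i 1 = 0) (hj0 : Nk j 0 = 0) (hj1 : Nk j 1 = 1)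
    (R : Matrix (Fin 4) (Fin 4) F) (T₀ : Matrix (Fin 2) (Fin 2) F) (hR : R * M₁ = M₁ * T₀) :
    R * Nk = Nk * Matrix.of (fun a c => (R * Nk) (![i, j] a) c) := by
  have key : ∀ S : Matrix (Fin 2) (Fin 2) F, Matrix.of (fun a c => (Nk * S) (![i, j] a) c) = S := by
    intro S
    ext a c
    fin_cases a <;> simp [Matrix.mul_apply, Fin.sum_univ_two, hi0, hi1, hj0, hj1]
  have hS : R * Nk = Nk * (A⁻¹ * T₀ * A) := by
    rw [hN]
    calc R * (M₁ * A) = M₁ * T₀ * A := by rw [← Matrix.mul_assoc, hR]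
      _ = M₁ * (A * A⁻¹) * T₀ * A := by rw [Matrix.mul_nonsing_inv A hA, Matrix.mul_one]
      _ = M₁ * A * (A⁻¹ * T₀ * A) := by simp only [Matrix.mul_assoc]
  rw [hS, key]

end IdentityRows

/-! ### Two pivot steps over `ℤ̄_p` -/

section Pivot

variable {p : ℕ} [Fact p.Prime]

/-- **Pivot.** A non-zero vector over `ℚ̄_p`, divided by an entry `v i` of maximal norm, is INTEGRAL with `i`-th
entry `1`. [folklore] -/
theorem exists_maxEntry_smul_mem_integer {ι : Type*} [Fintype ι] (v : ι → PadicAlgCl p) (hv : v ≠ 0) :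
    ∃ i, v i ≠ 0 ∧ ((v i)⁻¹ • v) i = 1 ∧ ∀ r, ((v i)⁻¹ • v) r ∈ Valued.integer (PadicAlgCl p) := by
  obtain ⟨r₀, hr₀⟩ := Function.ne_iff.mp hv
  obtain ⟨i, -, hi⟩ := Finset.exists_max_image (Finset.univ : Finset ι) (fun r => ‖v r‖)
    ⟨r₀, Finset.mem_univ _⟩
  have hle : ∀ r, ‖v r‖ ≤ ‖v i‖ := fun r => hi r (Finset.mem_univ r)
  have hvi : v i ≠ 0 := by
    intro h0
    apply hr₀
    have hr := hle r₀
    rw [h0, norm_zero] at hr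
    exact norm_le_zero_iff.mp hr
  refine ⟨i, hvi, ?_, fun r => ?_⟩
  · rw [Pi.smul_apply, smul_eq_mul, inv_mul_cancel₀ hvi]
  · rw [mem_integer_iff_norm_le_one, Pi.smul_apply, smul_eq_mul, norm_mul, norm_inv, inv_mul_eq_div]
    exact div_le_one_of_le₀ (hle r) (norm_nonneg _)

/-- **Saturation by two pivots.** For `M₁ : ℚ̄_p⁴ˣ²` with `M₁ *ᵥ ·` injective there are coefficient vectors
`b₁, b₂` and rows `i ≠ j` such that `M₁ *ᵥ b₁`, `M₁ *ᵥ b₂` are INTEGRAL with `(i, j)`-coordinates `(1, 0)` and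
`(0, 1)`. [folklore] -/
theorem exists_integral_saturatedPair (M₁ : Matrix (Fin 4) (Fin 2) (PadicAlgCl p))
    (hinj : ∀ a : Fin 2 → PadicAlgCl p, M₁ *ᵥ a = 0 → a = 0) :
    ∃ (b₁ b₂ : Fin 2 → PadicAlgCl p) (i j : Fin 4),
      i ≠ j ∧ (M₁ *ᵥ b₁) i = 1 ∧ (M₁ *ᵥ b₁) j = 0 ∧ (M₁ *ᵥ b₂) i = 0 ∧ (M₁ *ᵥ b₂) j = 1 ∧
      (∀ r, (M₁ *ᵥ b₁) r ∈ Valued.integer (PadicAlgCl p)) ∧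
      (∀ r, (M₁ *ᵥ b₂) r ∈ Valued.integer (PadicAlgCl p)) := by
  -- the two columns `m₁ = M₁ e₀`, `m₂ = M₁ e₁`
  obtain ⟨m₁, hm₁⟩ : ∃ v : Fin 4 → PadicAlgCl p, M₁ *ᵥ Pi.single 0 1 = v := ⟨_, rfl⟩
  obtain ⟨m₂, hm₂⟩ : ∃ v : Fin 4 → PadicAlgCl p, M₁ *ᵥ Pi.single 1 1 = v := ⟨_, rfl⟩
  have hm₁ne : m₁ ≠ 0 := by
    rintro rfl
    have h := congrFun (hinj _ hm₁) 0
    simp at h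
  -- pivot 1 : `n₁ = (m₁ i)⁻¹ m₁ = M₁ c₁`
  obtain ⟨i, -, hn₁i, hn₁int⟩ := exists_maxEntry_smul_mem_integer m₁ hm₁ne
  obtain ⟨c₁, hc₁⟩ : ∃ c : Fin 2 → PadicAlgCl p, (m₁ i)⁻¹ • Pi.single 0 1 = c := ⟨_, rfl⟩
  obtain ⟨n₁, hn₁⟩ : ∃ v : Fin 4 → PadicAlgCl p, M₁ *ᵥ c₁ = v := ⟨_, rfl⟩
  have hn₁eq : (m₁ i)⁻¹ • m₁ = n₁ := by rw [← hn₁, ← hc₁, Matrix.mulVec_smul, hm₁]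
  rw [hn₁eq] at hn₁i hn₁int
  -- pivot 2 : `m₂' = m₂ - (m₂ i) n₁ = M₁ c₂`, `n₂ = (m₂' j)⁻¹ m₂' = M₁ c₃`
  obtain ⟨c₂, hc₂⟩ : ∃ c : Fin 2 → PadicAlgCl p, Pi.single 1 1 - m₂ i • c₁ = c := ⟨_, rfl⟩
  obtain ⟨m₂', hm₂'⟩ : ∃ v : Fin 4 → PadicAlgCl p, M₁ *ᵥ c₂ = v := ⟨_, rfl⟩
  have hm₂'eq : m₂ - m₂ i • n₁ = m₂' := by
    rw [← hm₂', ← hc₂, Matrix.mulVec_sub, Matrix.mulVec_smul, hm₂, hn₁]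
  have hm₂'i : m₂' i = 0 := by
    rw [← hm₂'eq, Pi.sub_apply, Pi.smul_apply, hn₁i, smul_eq_mul, mul_one, sub_self]
  have hm₂'ne : m₂' ≠ 0 := by
    rintro rfl
    have h := congrFun (hinj _ hm₂') 1
    rw [← hc₂, ← hc₁] at h
    simp at h
  obtain ⟨j, hq₂, hn₂j, hn₂int⟩ := exists_maxEntry_smul_mem_integer m₂' hm₂'ne
  have hij : i ≠ j := by
    rintro rfl
    exact hq₂ hm₂'i
  obtain ⟨c₃, hc₃⟩ : ∃ c : Fin 2 → PadicAlgCl p, (m₂' j)⁻¹ • c₂ = c := ⟨_, rfl⟩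
  obtain ⟨n₂, hn₂⟩ : ∃ v : Fin 4 → PadicAlgCl p, M₁ *ᵥ c₃ = v := ⟨_, rfl⟩
  have hn₂eq : (m₂' j)⁻¹ • m₂' = n₂ := by rw [← hn₂, ← hc₃, Matrix.mulVec_smul, hm₂']
  rw [hn₂eq] at hn₂j hn₂int
  have hn₂i : n₂ i = 0 := by
    rw [← hn₂eq, Pi.smul_apply, smul_eq_mul, hm₂'i, mul_zero]
  -- clean-up : `n₁' = n₁ - (n₁ j) n₂ = M₁ c₄`
  obtain ⟨c₄, hc₄⟩ : ∃ c : Fin 2 → PadicAlgCl p, c₁ - n₁ j • c₃ = c := ⟨_, rfl⟩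
  have hn₁' : M₁ *ᵥ c₄ = n₁ - n₁ j • n₂ := by
    rw [← hc₄, Matrix.mulVec_sub, Matrix.mulVec_smul, hn₁, hn₂]
  refine ⟨c₄, c₃, i, j, hij, ?_, ?_, ?_, ?_, fun r => ?_, fun r => ?_⟩
  · rw [hn₁', Pi.sub_apply, Pi.smul_apply, hn₁i, hn₂i, smul_eq_mul, mul_zero, sub_zero]
  · rw [hn₁', Pi.sub_apply, Pi.smul_apply, hn₂j, smul_eq_mul, mul_one, sub_self]
  · rw [hn₂, hn₂i]
  · rw [hn₂, hn₂j]
  · rw [hn₁', Pi.sub_apply, Pi.smul_apply, smul_eq_mul]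
    exact sub_mem (hn₁int r) (mul_mem (hn₁int j) (hn₂int r))
  · rw [hn₂]
    exact hn₂int r

end Pivot

/-! ### Registered form -/

section Registered

/-- **Registered sub-goal T4 `stub_stablePlaneSaturation`** (crux stmt-Langlands-13639, line `sector-klingen-split`,
skeleton rev 7): a plane of `ℚ̄_p⁴` (column span of a rank-`2` matrix `M₁`) stable under integral matrices `rint g` has
an INTEGRAL basis `N = M₁ A` containing an identity `2 × 2` block in two rows `i ≠ j`, and the matrices `T g` of
`rint g` on the plane in that basis — rows `i, j` of `rint g * N` — are INTEGRAL with `rint g * N = N * T g`.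
[folklore] -/
theorem stub_stablePlaneSaturation :
    ∀ (p : ℕ) [Fact p.Prime] (Γ : Type)
      (rint : Γ → Matrix (Fin 4) (Fin 4) (Valued.integer (PadicAlgCl p)))
      (M₁ : Matrix (Fin 4) (Fin 2) (PadicAlgCl p)),
      (∀ a : Fin 2 → PadicAlgCl p, M₁ *ᵥ a = 0 → a = 0) →
      (∀ g, ∃ T : Matrix (Fin 2) (Fin 2) (PadicAlgCl p),
          (rint g).map (Valued.integer (PadicAlgCl p)).subtype * M₁ = M₁ * T) →
      ∃ (N : Matrix (Fin 4) (Fin 2) (Valued.integer (PadicAlgCl p)))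
        (A : Matrix (Fin 2) (Fin 2) (PadicAlgCl p)) (i j : Fin 4)
        (T : Γ → Matrix (Fin 2) (Fin 2) (Valued.integer (PadicAlgCl p))),
        i ≠ j ∧ N i 0 = 1 ∧ N i 1 = 0 ∧ N j 0 = 0 ∧ N j 1 = 1 ∧ IsUnit A.det ∧
        N.map (Valued.integer (PadicAlgCl p)).subtype = M₁ * A ∧
        ∀ g, rint g * N = N * T g := by
  intro p _ Γ rint M₁ hinj hstab
  obtain ⟨b₁, b₂, i, j, hij, hi0, hj0, hi1, hj1, hint₁, hint₂⟩ := exists_integral_saturatedPair M₁ hinj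
  -- the coefficient matrix `A = (b₁ | b₂)` and the saturated basis `Nk = M₁ A = (M₁ b₁ | M₁ b₂)`
  obtain ⟨A, hA⟩ : ∃ A : Matrix (Fin 2) (Fin 2) (PadicAlgCl p), Matrix.of (fun r c => ![b₁, b₂] c r) = A :=
    ⟨_, rfl⟩
  obtain ⟨Nk, hNk⟩ : ∃ Nk : Matrix (Fin 4) (Fin 2) (PadicAlgCl p), M₁ * A = Nk := ⟨_, rfl⟩
  have hNk0 : ∀ r, Nk r 0 = (M₁ *ᵥ b₁) r := fun r => by
    simp [← hNk, ← hA, Matrix.mul_apply, Matrix.mulVec, dotProduct]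
  have hNk1 : ∀ r, Nk r 1 = (M₁ *ᵥ b₂) r := fun r => by
    simp [← hNk, ← hA, Matrix.mul_apply, Matrix.mulVec, dotProduct]
  have hNi0 : Nk i 0 = 1 := by rw [hNk0, hi0]
  have hNi1 : Nk i 1 = 0 := by rw [hNk1, hi1]
  have hNj0 : Nk j 0 = 0 := by rw [hNk0, hj0]
  have hNj1 : Nk j 1 = 1 := by rw [hNk1, hj1]
  have hNint : ∀ r c, Nk r c ∈ Valued.integer (PadicAlgCl p) := fun r =>
    Fin.forall_fin_two.mpr ⟨(hNk0 r).symm ▸ hint₁ r, (hNk1 r).symm ▸ hint₂ r⟩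
  have hAdet : IsUnit A.det :=
    isUnit_det_of_identityRows M₁ A i j (hNk ▸ hNi0) (hNk ▸ hNi1) (hNk ▸ hNj0) (hNk ▸ hNj1)
  -- the integral matrix `N` with `N.map subtype = Nk`
  set N : Matrix (Fin 4) (Fin 2) (Valued.integer (PadicAlgCl p)) := Matrix.of fun r c => ⟨Nk r c, hNint r c⟩
  have hNmap : N.map (Valued.integer (PadicAlgCl p)).subtype = Nk := by
    ext r c
    rfl
  refine ⟨N, A, i, j, fun g => Matrix.of fun a c => (rint g * N) (![i, j] a) c, hij,
    Subtype.ext hNi0, Subtype.ext hNi1, Subtype.ext hNj0, Subtype.ext hNj1, hAdet, hNk ▸ hNmap, fun g => ?_⟩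
  -- stability : compare over `ℚ̄_p`
  obtain ⟨T₀, hT₀⟩ := hstab g
  apply Matrix.map_injective (Valued.integer (PadicAlgCl p)).subtype_injective
  have hTmap : (Matrix.of fun a c => (rint g * N) (![i, j] a) c).map ⇑(Valued.integer (PadicAlgCl p)).subtype
      = Matrix.of fun a c => ((rint g * N).map ⇑(Valued.integer (PadicAlgCl p)).subtype) (![i, j] a) c := by
    ext a c
    rfl
  show (rint g * N).map ⇑(Valued.integer (PadicAlgCl p)).subtype
    = (N * Matrix.of fun a c => (rint g * N) (![i, j] a) c).map ⇑(Valued.integer (PadicAlgCl p)).subtype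
  rw [Matrix.map_mul, Matrix.map_mul, hTmap, Matrix.map_mul, hNmap]
  exact mul_eq_mul_of_identityRows M₁ Nk A hAdet hNk.symm i j hNi0 hNi1 hNj0 hNj1 _ T₀ hT₀

end Registered

end Summit.Langlands.Langlands.Cruxes.ResiduallyYoshidaLifting.SectorKlingenSplit.Fibre

end
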